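import Summits.Ventures.LatticeQCDFlow.Scaling.FlowTemperingConjugacy
import Summits.Ventures.LatticeQCDFlow.Scaling.SimulatedTemperingTunnelingTime

/-!
HONEST FRAMING: exact (Metropolis-corrected) sampling algorithms for lattice gauge theory; figures
of merit are autocorrelation/cost numbers at stated couplings and volumes; no continuum-physics
claim.

# FlowSamplerTunnelingTime — THE FLOORS OF CHAPTER I AS TUNNELLING TIMES: FROM EQUILIBRIUM, COLD REPLICA `k` OF THE
# HOT-ONLY (MAP-ASSISTED) HUB ENTERS A SECTOR `A` WITHIN `10K·(1−μ_k(A))/(min{t,γ₀(1−t)}·μ_k(A))` EXPECTED STEPS, AND OF A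
# LADDER WITH PERFECT ADJACENT TRANSPORTS WITHIN `(1−μ_k(A))/(min{t/(6K²(K+1)), γ₀(1−t)/(6(K+1)²)}·μ_k(A))`, AND THE
# TEMPERING WALKER WITH PERFECT TRANSPORTS REACHES "LEVEL `k`, SECTOR `A_j`" WITHIN
# `(1 − μ_k(A_j)/(K+1))/((min{1/K,γ₀}/(25(K+1)))·μ_k(A_j)/(K+1))` — WHATEVER THE COLD LAWS AND THE COLD UPDATES
# (lean-2 GEN-21, ours)

Venture-side (OURS).  Cell `lqcd-flow` (pub-lqcd), unit `pub-lqcd-lean-2-g21`, 2026-08-26.  Chapter I, fifth file: the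
currency practitioners measure (tunnelling events of the topological charge) for the relaxation guarantees of
`Scaling/WeightedHubSchemeFloor` (I1), `Scaling/FlowHubSchemeFloor` (I2), `Scaling/FlowLadderConjugacy` (I3) and
`Scaling/FlowTemperingConjugacy` (I4), through the equilibrium exit ceiling of `Scaling/EquilibriumExitCeiling` (E1:
`Σ_x π(x)E_x(τ_A ∧ N) ≤ π(Aᶜ)/(γ·π(A))` for a stationary chain with Poincaré constant `γ`) — the pattern of
`Scaling/ReplicaExchangeTunnelingTime` / `Scaling/SimulatedTemperingTunnelingTime` (E2/E3).  Target sets: "replica `k`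
sits in the sector `A`", `T_{k,A} = {x : x_k ∈ A}`, of `π̃`-mass `μ_k(A)` (`tensorFun_mass_levelSector`); for the tempering
walker "level `k` and sector `A_j`", of mass `μ_k(A_j)/(K+1)` (E3's `stFin_levelSector_mass`).

## What is proved

* `tensorFun_mass_levelSector` (`π̃{x_k ∈ A} = μ_k(A)`); **`tunnelingTime_le_of_gapFloor`** — for ANY `π̃`-reversible
  transition matrix `P` with `Gap(P) ≥ c > 0`: `Σ_x π̃(x)·E_x(τ_{T_{k,A}} ∧ N) ≤ (1 − μ_k(A))/(c·μ_k(A))` for every `N`.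
* **`hotOnlyStar_tunnelingTime_le`** (I1's hot-only star, identical levels: `c = min{t,γ₀(1−t)}/(10K)`);
  **`flowStarPerfect_tunnelingTime_le`** (I2's map-assisted star with perfect transports, ARBITRARY cold laws: same `c`);
  **`flowLadderPerfect_tunnelingTime_le`** (I3's ladder with perfect adjacent transports, ARBITRARY cold laws:
  `c = min{t/(6K²(K+1)), γ₀(1−t)/(6(K+1)²)}`); **`flowTemperingPerfect_tunnelingTime_le`** (I4's tempering walker with
  perfect adjacent transports, ARBITRARY cold laws: `c = min{1/K, γ₀}/(25(K+1))`, target "level `k`, sector `A_j`").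

Reading (no numerics implied): started from its stationary law, a cold replica of the hot-weighted hub waits order `K`
steps for a sector it does not hold, one of the perfect-map ladder order `K³`, the perfect-map tempering walker order `K³`
for a prescribed (level, sector) pair of mass `~1/K` — with constants from the hot replica alone, for every family of cold
laws.  NOT CLAIMED: worst-case starts (these are equilibrium averages, as
in E1/E2); continuous spaces; anything measured.  Literature grade (cell rule): OWN COROLLARIES; nothing cited as a fact;
no new bib keys.
-/

noncomputable section

open Finset Function
open Literature.Probability.MarkovChains
open Literature.Probability.MarkovChains.Decomposition

namespace Summit.Ventures.LatticeQCDFlow.Scaling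

variable {S : Type*} [Fintype S] [DecidableEq S] {K : ℕ} {μ : Fin (K + 1) → S → ℝ}
  {M : Fin (K + 1) → S → S → ℝ} {t : ℝ}

omit [DecidableEq S] in
/-- The `π̃`-mass of `{x : x_k ∈ A}` is `μ_k(A)`. [ours] -/
theorem tensorFun_mass_levelSector [DecidableEq S] (hμ1 : ∀ k, ∑ u, μ k u = 1) (k : Fin (K + 1)) (A : Finset S) :
    ∑ x ∈ univ.filter (fun x : Fin (K + 1) → S => x k ∈ A), tensorFun μ x = ∑ u ∈ A, μ k u := by
  have h := sum_tensorFun_mul_apply μ hμ1 k (fun u => if u ∈ A then (1 : ℝ) else 0)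
  simp_rw [mul_ite, mul_one, mul_zero] at h
  rwa [← Finset.sum_filter, ← Finset.sum_filter, Finset.filter_mem_eq_inter, Finset.univ_inter] at h

/-- **TUNNELLING TIME FROM A GAP FLOOR:** for a `π̃`-reversible transition matrix `P` with `Gap(P) ≥ c > 0` and a sector
`A` with `μ_k(A) > 0`: `Σ_x π̃(x)·E_x(τ_{x_k ∈ A} ∧ N) ≤ (1 − μ_k(A))/(c·μ_k(A))` for every horizon `N` (`|S| ≥ 2`). [ours] -/
theorem tunnelingTime_le_of_gapFloor [Nontrivial S] (hμ : ∀ k x, 0 < μ k x) (hμ1 : ∀ k, ∑ u, μ k u = 1)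
    {P : Matrix (Fin (K + 1) → S) (Fin (K + 1) → S) ℝ} (hP : IsRowStochastic P) (hDB : DetailedBalance (tensorFun μ) P)
    {c : ℝ} (hc0 : 0 < c) (hc : c ≤ spectralGap (tensorFun μ) P) (k : Fin (K + 1)) {A : Finset S}
    (hA : 0 < ∑ u ∈ A, μ k u) (N : ℕ) :
    ∑ x, tensorFun μ x * meanHitWithin P (↑(univ.filter (fun x : Fin (K + 1) → S => x k ∈ A)) : Set (Fin (K + 1) → S)) N x
      ≤ (1 - ∑ u ∈ A, μ k u) / (c * ∑ u ∈ A, μ k u) := by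
  have hst := hDB.isStationary hP.2
  have hgap : ∀ f : (Fin (K + 1) → S) → ℝ, c * lawVariance (tensorFun μ) f ≤ dirichletForm (tensorFun μ) P f := fun f =>
    (mul_le_mul_of_nonneg_right hc (lawVariance_nonneg (fun x => (tensorFun_pos hμ x).le) f)).trans
      (LevinPeres2017_remark_13_8 (tensorFun_pos hμ) (sum_tensorFun_eq_one μ hμ1) hP hDB f)
  have hmass := tensorFun_mass_levelSector (μ := μ) hμ1 k A
  have hA' : 0 < ∑ x ∈ univ.filter (fun x : Fin (K + 1) → S => x k ∈ A), tensorFun μ x := by rw [hmass]; exact hA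
  have h := equilibrium_meanHitWithin_le (fun x => (tensorFun_pos hμ x).le) (sum_tensorFun_eq_one μ hμ1) hP hst hc0
    hgap _ hA' N
  have hcompl : ∑ x ∈ (univ.filter (fun x : Fin (K + 1) → S => x k ∈ A))ᶜ, tensorFun μ x = 1 - ∑ u ∈ A, μ k u := by
    have e := Finset.sum_add_sum_compl (univ.filter (fun x : Fin (K + 1) → S => x k ∈ A)) (tensorFun μ)
    rw [sum_tensorFun_eq_one μ hμ1, hmass] at e
    linarith
  rwa [hcompl, hmass] at h

/-- **HOT-ONLY HUB:** identical levels, hot Poincaré constant `γ₀`, cold updates arbitrary `μ_k`-reversible, `μ_k(A) > 0`: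
from equilibrium, replica `k` enters `A` within `(1 − μ_k(A))/((min{t,γ₀(1−t)}/(10K))·μ_k(A))` expected steps. [ours] -/
theorem hotOnlyStar_tunnelingTime_le [Nontrivial S] (hK : 1 ≤ K) (hμ : ∀ k x, 0 < μ k x) (hμ1 : ∀ k, ∑ u, μ k u = 1)
    (hM : ∀ k, IsRowStochastic (M k)) (hMrev : ∀ k, DetailedBalance (μ k) (M k)) (ht0 : 0 < t) (ht1 : t < 1)
    (hsame : ∀ k, μ k = μ 0) {γ₀ : ℝ} (hγ₀ : 0 < γ₀)
    (hgap0 : ∀ h : S → ℝ, γ₀ * lawVariance (μ 0) h ≤ dirichletForm (μ 0) (M 0) h) (k : Fin (K + 1)) {A : Finset S}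
    (hA : 0 < ∑ u ∈ A, μ k u) (N : ℕ) :
    ∑ x, tensorFun μ x * meanHitWithin (fun x y : Fin (K + 1) → S =>
          t * ptGraphSwap μ (fun k : Fin K => ((0 : Fin (K + 1)), k.succ)) (fun _ : Fin K => Equiv.refl S) x y
            + (1 - t) * prodKernel (fun k : Fin (K + 1) => if k = 0 then (1 : ℝ) else 0) M x y)
        (↑(univ.filter (fun x : Fin (K + 1) → S => x k ∈ A)) : Set (Fin (K + 1) → S)) N x
      ≤ (1 - ∑ u ∈ A, μ k u) / (min t (γ₀ * (1 - t)) / (10 * K) * ∑ u ∈ A, μ k u) := by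
  have hKpos : (0 : ℝ) < K := Nat.cast_pos.mpr (by omega)
  have hw0 : ∀ k : Fin (K + 1), 0 ≤ (if k = 0 then (1 : ℝ) else 0) := fun k => by positivity
  exact tunnelingTime_le_of_gapFloor hμ hμ1
    (weightedScheme_isRowStochastic (ptGraphSwap_isRowStochastic hμ) hM hw0 hotOnlyWeight_sum ht0.le ht1.le)
    (weightedScheme_detailedBalance (ptGraphSwap_detailedBalance hμ) hMrev t)
    (div_pos (lt_min ht0 (mul_pos hγ₀ (by linarith))) (by positivity))
    (hotOnlyStar_spectralGap_ge_linear hK hμ hμ1 hM hMrev ht0 ht1 hsame hγ₀ hgap0) k hA N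

/-- **MAP-ASSISTED HUB WITH PERFECT TRANSPORTS** (`μ_{k+1}∘φ_k = μ_0`, hot-only updates; ARBITRARY cold laws and cold
updates): the same ceiling `(1 − μ_k(A))/((min{t,γ₀(1−t)}/(10K))·μ_k(A))`. [ours] -/
theorem flowStarPerfect_tunnelingTime_le [Nontrivial S] (φ : Fin K → Equiv.Perm S) (hK : 1 ≤ K)
    (hμ : ∀ k x, 0 < μ k x) (hμ1 : ∀ k, ∑ u, μ k u = 1) (hM : ∀ k, IsRowStochastic (M k))
    (hMrev : ∀ k, DetailedBalance (μ k) (M k)) (ht0 : 0 < t) (ht1 : t < 1)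
    (hperfect : ∀ (k : Fin K) (u : S), μ k.succ (φ k u) = μ 0 u) {γ₀ : ℝ} (hγ₀ : 0 < γ₀)
    (hgap0 : ∀ h : S → ℝ, γ₀ * lawVariance (μ 0) h ≤ dirichletForm (μ 0) (M 0) h) (k : Fin (K + 1)) {A : Finset S}
    (hA : 0 < ∑ u ∈ A, μ k u) (N : ℕ) :
    ∑ x, tensorFun μ x * meanHitWithin (fun x y : Fin (K + 1) → S =>
          t * ptGraphSwap μ (fun k : Fin K => ((0 : Fin (K + 1)), k.succ)) φ x y
            + (1 - t) * prodKernel (fun k : Fin (K + 1) => if k = 0 then (1 : ℝ) else 0) M x y)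
        (↑(univ.filter (fun x : Fin (K + 1) → S => x k ∈ A)) : Set (Fin (K + 1) → S)) N x
      ≤ (1 - ∑ u ∈ A, μ k u) / (min t (γ₀ * (1 - t)) / (10 * K) * ∑ u ∈ A, μ k u) := by
  have hKpos : (0 : ℝ) < K := Nat.cast_pos.mpr (by omega)
  have hw0 : ∀ k : Fin (K + 1), 0 ≤ (if k = 0 then (1 : ℝ) else 0) := fun k => by positivity
  exact tunnelingTime_le_of_gapFloor hμ hμ1
    (weightedScheme_isRowStochastic (ptGraphSwap_isRowStochastic hμ) hM hw0 hotOnlyWeight_sum ht0.le ht1.le)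
    (weightedScheme_detailedBalance (ptGraphSwap_detailedBalance hμ) hMrev t)
    (div_pos (lt_min ht0 (mul_pos hγ₀ (by linarith))) (by positivity))
    (flowStarPerfect_spectralGap_ge_linear φ hK hμ hμ1 hM hMrev ht0 ht1 hperfect hγ₀ hgap0) k hA N

/-- **LADDER WITH PERFECT ADJACENT TRANSPORTS** (`μ_{j+1}∘φ_j = μ_j`; ARBITRARY cold laws, arbitrary `μ_k`-reversible cold
updates): from equilibrium, replica `k` enters `A` within
`(1 − μ_k(A))/(min{t/(6K²(K+1)), γ₀(1−t)/(6(K+1)²)}·μ_k(A))` expected steps. [ours] -/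
theorem flowLadderPerfect_tunnelingTime_le [Nontrivial S] (φ : Fin K → Equiv.Perm S) (hK : 1 ≤ K)
    (hμ : ∀ k x, 0 < μ k x) (hμ1 : ∀ k, ∑ u, μ k u = 1) (hM : ∀ k, IsRowStochastic (M k))
    (hMrev : ∀ k, DetailedBalance (μ k) (M k)) (ht0 : 0 < t) (ht1 : t < 1)
    (hperfect : ∀ (j : Fin K) (u : S), μ j.succ (φ j u) = μ j.castSucc u) {γ₀ : ℝ} (hγ₀ : 0 < γ₀)
    (hgap0 : ∀ h : S → ℝ, γ₀ * lawVariance (μ 0) h ≤ dirichletForm (μ 0) (M 0) h) (k : Fin (K + 1)) {A : Finset S}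
    (hA : 0 < ∑ u ∈ A, μ k u) (N : ℕ) :
    ∑ x, tensorFun μ x * meanHitWithin (ptFlowSampler t μ M φ)
        (↑(univ.filter (fun x : Fin (K + 1) → S => x k ∈ A)) : Set (Fin (K + 1) → S)) N x
      ≤ (1 - ∑ u ∈ A, μ k u) / (min (t / (6 * K ^ 2 * (K + 1))) (γ₀ * (1 - t) / (6 * (K + 1) ^ 2)) * ∑ u ∈ A, μ k u) := by
  have hKpos : (0 : ℝ) < K := Nat.cast_pos.mpr (by omega)
  exact tunnelingTime_le_of_gapFloor hμ hμ1 (ptFlowSampler_isRowStochastic hμ hM ht0.le ht1.le)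
    (ptFlowSampler_detailedBalance hμ hMrev)
    (lt_min (by positivity) (div_pos (mul_pos hγ₀ (by linarith)) (by positivity)))
    (flowLadderPerfect_spectralGap_ge_of_adjacent φ hK hμ hμ1 hM hMrev ht0 ht1 hperfect hγ₀ hgap0) k hA N

/-! ## The tempering walker -/

section Tempering
variable {J : Type*} [DecidableEq J] {Mst : Fin (K + 1) → Matrix S S ℝ} {mode : S → J}

/-- **TEMPERING WITH PERFECT ADJACENT TRANSPORTS** (`μ_{j+1}∘φ_j = μ_j`; ARBITRARY cold laws, arbitrary `μ_k`-reversible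
within-level updates, even the identity): for every level `k`, sector `j` (of a surjective `mode : S → J`) and horizon `N`,
`Σ_q π(q)·E_q(τ_{level k ∧ sector j} ∧ N) ≤ (1 − μ_k(A_j)/(K+1))/((min{1/K, γ₀}/(25(K+1)))·μ_k(A_j)/(K+1))`. [ours] -/
theorem flowTemperingPerfect_tunnelingTime_le (φ : Fin K → Equiv.Perm S) (hK : 1 ≤ K) (hμ : ∀ k x, 0 < μ k x)
    (hμ1 : ∀ k, ∑ x, μ k x = 1) (hmode : Function.Surjective mode) (hM : ∀ k, IsRowStochastic (Mst k))
    (hMrev : ∀ k, DetailedBalance (μ k) (Mst k)) (hperfect : ∀ (j : Fin K) (u : S), μ j.succ (φ j u) = μ j.castSucc u)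
    {γ₀ : ℝ} (hγ₀ : 0 < γ₀) (hgap0 : ∀ h : S → ℝ, γ₀ * lawVariance (μ 0) h ≤ dirichletForm (μ 0) (Mst 0) h)
    (k : Fin (K + 1)) (j : J) (N : ℕ) :
    ∑ q, stFinLaw μ q * meanHitWithin (stFlowSampler (1 / 2) μ Mst φ)
        (↑(univ.filter (fun p : Fin (K + 1) × S => p.1 = k ∧ mode p.2 = j)) : Set (Fin (K + 1) × S)) N q
      ≤ (1 - blockMass (μ k) mode j / (K + 1))
          / (min (1 / (K : ℝ)) γ₀ / (25 * (K + 1)) * (blockMass (μ k) mode j / (K + 1))) := by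
  haveI : Nonempty S := by
    by_contra h
    rw [not_nonempty_iff] at h
    have := hμ1 0
    rw [Finset.univ_eq_empty, Finset.sum_empty] at this
    exact zero_ne_one this
  haveI : Nontrivial (Fin (K + 1)) := Fin.nontrivial_iff_two_le.mpr (by omega)
  have ht0 : (0 : ℝ) < 1 / 2 := by norm_num
  have ht1 : (1 / 2 : ℝ) < 1 := by norm_num
  have hKr : (1 : ℝ) ≤ K := by exact_mod_cast hK
  have hP := stFlowSampler_isRowStochastic (M := Mst) (φ := φ) hμ hM ht0.le ht1.le
  have hDB := stFlowSampler_detailedBalance (t := (1 / 2 : ℝ)) (M := Mst) (φ := φ) hμ hMrev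
  have hst : IsStationary (stFinLaw μ) (stFlowSampler (1 / 2) μ Mst φ) := hDB.isStationary hP.2
  set c := min (1 / (K : ℝ)) γ₀ / (25 * (K + 1)) with hcdef
  have hcpos : 0 < c := div_pos (lt_min (by positivity) hγ₀) (by positivity)
  have hc : c ≤ spectralGap (stFinLaw μ) (stFlowSampler (1 / 2) μ Mst φ) :=
    flowTemperingPerfect_spectralGap_ge_of_adjacent φ hK hμ hμ1 hM hMrev hperfect hγ₀ hgap0
  have hgap : ∀ f : Fin (K + 1) × S → ℝ,
      c * lawVariance (stFinLaw μ) f ≤ dirichletForm (stFinLaw μ) (stFlowSampler (1 / 2) μ Mst φ) f := fun f =>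
    (mul_le_mul_of_nonneg_right hc (lawVariance_nonneg (fun q => (stFinLaw_pos hμ q).le) f)).trans
      (LevinPeres2017_remark_13_8 (stFinLaw_pos hμ) (sum_stFinLaw hμ1) hP hDB f)
  have hA : 0 < ∑ p ∈ univ.filter (fun p : Fin (K + 1) × S => p.1 = k ∧ mode p.2 = j), stFinLaw μ p := by
    rw [stFin_levelSector_mass k j]; exact div_pos (blockMass_pos (hμ k) hmode j) (by positivity)
  have h := equilibrium_meanHitWithin_le (fun q => (stFinLaw_pos hμ q).le) (sum_stFinLaw hμ1) hP hst hcpos hgap _ hA N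
  rw [stFin_levelSector_mass k j, stFin_levelSector_mass_compl hμ1 k j] at h
  exact h

end Tempering

end Summit.Ventures.LatticeQCDFlow.Scaling

end
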